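import Summits.QuantumFields.BalabanUV.Beta.WardLocusQuarticTable
import Summits.QuantumFields.BalabanUV.Beta.WardLocusRecursiveStep

/-!
# `BalabanUV.Beta.WardLocusRecursiveAll` — binder row D1, (L4) W-side of hW, «D1-hW-L4-WARD-ALL» part C: THE LEVEL RECURSION OF THE WARD KERNEL LAW OF
# THE W-LITERAL `WrecAt` — level 0 from the three level-0 LETTERS (Wilson, border, mixed), level `j+1` from the level-`j` kernel law + the two level-(j+1)
# LETTERS (border, mixed) + the pin `cE₂ = Lc^{2(d+1)}` — part A (`WardLocusQuarticTable`: table laws) ∘ part B (`WardLocusRecursiveStep`: kernel law from table laws)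
# (β sub-cell, D1 formalisation swarm, unit `b2b-balaban-beta-d1-formalise-leaf-06`, gen 3; CLAIM «D1-hW-L4-WARD-ALL» journal 2026-08-20)

NOT IN PRINT; OUR BOOKKEEPING.  HONEST FRAMING (cell charter, verbatim): «discharging `BetaPertH` makes Bałaban's UV stability UNCONDITIONAL — a real
constructive-QFT result; it is NOT the continuum limit and NOT the Clay problem.»  HONEST DEPENDENCY (verbatim): «continuum YM on T⁴ ⇐ BetaPertH ∧ nine spine
estimates (0/9 proved); BetaPertH ⇐ (D1) ∧ (D4) ∧ CAP+tail; G-an2-4 gates asym, D1 and NE2/3/4.»  [folklore] composition of parts A and B; the LETTERS (an1's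
border (T2-B) and mixed (T2-M₂) laws, the level-0 Wilson law — for `T := wsym22 N` leaf-09-g4's `WilsonBiStencilWardSocket.hS₂_wilson`) with their remainders,
the uniform bound of the transported residual, and the pin are DISPLAYED HYPOTHESES; no statement of Bałaban's papers, no `[cite:]`, no `def`, no
`def … : Prop`; instantiates NO binder of the β-function wall.  NOT hW, NOT D1, NOT `BetaPertH`, NOT continuum, NOT Clay.

* §1 **`divW_WrecAt_zero_of_letters`** — the level-0 KERNEL law `hWd 0` of `WrecAt 0` (conjV form, explicit residual) from the Wilson letters (both slots,
  remainders `RW`, `RW″`), the border letters (both slots, `RB`, `RB″`) and the mixed letter (`RM`), all bounded; + `loc_residual_WrecAt_zero` (its residual is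
  localised when `RW y`, `RB y`, `RW″ y`, `RB″ y` are local-stencil families and `RM y` a vertex family).
* §2 **`divW_WrecAt_succ_of_kernelLaw`** — THE INDUCTION STEP `hWd j ⟹ hWd (j+1)`: from the level-`j` kernel law with a localised residual `𝒩` whose
  `G_j`-sandwich block sums are uniformly bounded (`h𝒩b`), the level-(j+1) border letters (both slots) and mixed letter (bounded remainders), and the pin
  `cE₂ = Lc^{2(d+1)}` (part A `lock_succ_of_pin`) ⇒ the level-(j+1) kernel law with its residual DISPLAYED.
WHAT IS NOT HERE (named, for the next seat — the hW twin of hR's (W-CLASS-Q)): the QUANTITATIVE class propagation of the residual (`Nr j` bi-localised with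
constants good enough that the next level's remainder `−c • Σ_v mmRead (G_j∘Nr j∘G_j) + RB` is again a local-stencil family and `h𝒩b` holds), and the residual's
row parity; with those, §1 + §2 give `∀ j, hWd j` by induction and part B §3 `wardTransversal_flipK_TbalOf_JsRecWAtOf_of_kernelLaws` gives hW(v2.26-W) from the
letters.  Provenance: D1 formalisation swarm, leaf prover 06 (gen 3), 2026-08-20; no existing file touched.
-/

noncomputable section

open Finset
open scoped BigOperators
open Literature.MathematicalPhysics.QuantumFieldTheory
open Literature.MathematicalPhysics.QuantumFieldTheory.Balaban1983to89
open Literature.MathematicalPhysics.QuantumFieldTheory.Balaban1983to89.Beta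
open B12Sec2to5 (l1 l1_nonneg)
open ExpKernelCalculus (MKer Decays BiLoc VertexFamily VertexFamily₂ comp)
open KernelWard (divV divW)
open AffineAveraging (Site box toSite)
open OneStepResolventKernel (Fib wsum LocStencil)
open OneStepKernelFamily (KInvStep colH vertexOfK)
open InterLevelTransport (cwsum)
open BalabanStepJetsSucc (mmRead wE wVH)
open SecondOrderResponse (colM vertexOfM dM K2OfK LocStencilFM)
open BalabanCompositeJets (LocStencil₂)
open BalabanStepW2 (M2Of wV4 wB2)
open StepJetData (wilsonA locStencil_add)
open WilsonBiStencil (wilsonW₂)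
open AveragingHessianKernelsRooted (vhSAt)
open Summit.QuantumFields.BalabanUV.Beta.TameKernelCalculus
open Summit.QuantumFields.BalabanUV.Beta.ChartConjugation (conjV)
open Summit.QuantumFields.BalabanUV.Beta.BorderedHessian (diagK bhKStepAt stepScale)
open Summit.QuantumFields.BalabanUV.Beta.AveragingWardRootedStencils (legInd)
open Summit.QuantumFields.BalabanUV.Beta.AxialDressingRooted (coDressKBmAt axEc)
open Summit.QuantumFields.BalabanUV.Beta.SpineRooted (e4OfKW SpureRecAt M1At T2RecAt WrecAt)
open Summit.QuantumFields.BalabanUV.Beta.KernelWardRelative (gaugeWt)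
open Summit.QuantumFields.BalabanUV.Beta.WardLocusQuarticTable (tableLaw_T2RecAt_succ tableLaw_T2RecAt_succ'' tableLaw_T2RecAt_zero tableLaw_T2RecAt_zero''
  lock_succ_of_pin)
open Summit.QuantumFields.BalabanUV.Beta.WardLocusRecursiveStep (divW_WrecAt_of_tableLaws loc_residual_WrecAt)

namespace Summit.QuantumFields.BalabanUV.Beta.WardLocusRecursiveAll

section Wall

variable {d Lc : ℕ} [NeZero Lc]

/-- [folklore] A scaled kernel plus a bounded kernel is bounded (entrywise bookkeeping for the remainder bounds). -/
theorem abs_smul_add_le {A B : MKer (d + 1) (Fib d)} (a : ℝ) {BA BB : ℝ} (hA : ∀ x z p q, |A x z p q| ≤ BA) (hB : ∀ x z p q, |B x z p q| ≤ BB)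
    (x z : Fin (d + 1) → ℤ) (p q : Fib d) : |(a • A + B) x z p q| ≤ |a| * BA + BB := by
  simp only [Pi.add_apply, Pi.smul_apply, smul_eq_mul]
  refine (abs_add_le _ _).trans (add_le_add ?_ (hB x z p q))
  rw [abs_mul]
  exact mul_le_mul_of_nonneg_left (hA x z p q) (abs_nonneg a)

/-- [folklore] A sum of two bounded kernels is bounded. -/
theorem abs_add_le' {A B : MKer (d + 1) (Fib d)} {BA BB : ℝ} (hA : ∀ x z p q, |A x z p q| ≤ BA) (hB : ∀ x z p q, |B x z p q| ≤ BB)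
    (x z : Fin (d + 1) → ℤ) (p q : Fib d) : |(A + B) x z p q| ≤ BA + BB := by
  simp only [Pi.add_apply]
  exact (abs_add_le _ _).trans (add_le_add (hA x z p q) (hB x z p q))

/-! ## §1 Level 0: the kernel law of `WrecAt 0` from the three level-0 letters -/

/-- [folklore] **THE LEVEL-0 WARD KERNEL LAW `hWd 0` OF THE W-LITERAL FROM THE LEVEL-0 LETTERS** (hW Ward pin, in-block root `ρ = toSite r`, generator
`X y = diagK (½ • Σ_v legInd ρ (Lc•y+v))`, constant `cH₀ = (stepScale 0·Lc^{d+1})⁻¹`).  LETTERS (displayed hypotheses, bounded remainders): the WILSON letter of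
`cE₂ • wilsonW₂ d T` against `Lc^{d+1} • wilsonA d` in both slots (`hWil`, `hWil''`), the BORDER letter of `cB • vh₂S` against `cVH • vhSAt ρ` in both slots
(`hBord`, `hBord''`), the MIXED letter of `M2Of mixFF 0` against `M1At 0` (`hM₂`).  CONCLUSION: part B's kernel law at `j = 0` with `R := RW + RB`, `R″ := RW″ + RB″`. -/
theorem divW_WrecAt_zero_of_letters (hLc : 1 ≤ Lc) {r : Fin (d + 1) → ℕ} (hr : r ∈ box (d + 1) Lc) (cΛ cE₂ cB : ℝ)
    (T : Fin 4 → Fin 4 → Fin 4 → Fin 4 → ℝ)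
    {vh₂S : Fin (d + 1) → (Fin (d + 1) → ℤ) → Fin (d + 1) → (Fin (d + 1) → ℤ) → MKer (d + 1) (Fib d)}
    (hB : ∃ C δ : ℝ, 0 < δ ∧ LocStencil₂ vh₂S C δ)
    {mixFF : Fin (d + 1) → (Fin (d + 1) → ℤ) → Fin (d + 1) → (Fin (d + 1) → ℤ) → MKer (d + 1) (Fib d)}
    (hmix : ∃ C δ : ℝ, 0 < δ ∧ LocStencilFM Lc mixFF C δ)
    {RW RW'' RB RB'' : (Fin (d + 1) → ℤ) → Fin (d + 1) → (Fin (d + 1) → ℤ) → MKer (d + 1) (Fib d)} {BW BW'' BB BB'' : ℝ}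
    (hRWb : ∀ y κ u x z a b, |RW y κ u x z a b| ≤ BW) (hRW''b : ∀ y κ u x z a b, |RW'' y κ u x z a b| ≤ BW'')
    (hRBb : ∀ y κ u x z a b, |RB y κ u x z a b| ≤ BB) (hRB''b : ∀ y κ u x z a b, |RB'' y κ u x z a b| ≤ BB'')
    {RM : (Fin (d + 1) → ℤ) → Fin (d + 1) → (Fin (d + 1) → ℤ) → MKer (d + 1) (Fib d)} {BR' : ℝ}
    (hRMb : ∀ y ρ w x z a b, |RM y ρ w x z a b| ≤ BR')
    (hWil : ∀ (Y : Fin (d + 1) → ℤ) (κ' : Fin (d + 1)) (u' : Fin (d + 1) → ℤ),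
      (stepScale d Lc 0 * (Lc : ℝ) ^ (d + 1))⁻¹ • ∑ v ∈ box (d + 1) Lc, divV (fun κ u => cE₂ • wilsonW₂ d T κ u κ' u') ((Lc : ℤ) • Y + toSite v) =
        comp (((Lc : ℝ) ^ (d + 1)) • wilsonA d κ' u') (diagK (((1 : ℝ) / 2) • ∑ v ∈ box (d + 1) Lc, legInd (toSite r) ((Lc : ℤ) • Y + toSite v)))
          - comp (diagK (((1 : ℝ) / 2) • ∑ v ∈ box (d + 1) Lc, legInd (toSite r) ((Lc : ℤ) • Y + toSite v))) (((Lc : ℝ) ^ (d + 1)) • wilsonA d κ' u')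
          + RW Y κ' u')
    (hWil'' : ∀ (Y : Fin (d + 1) → ℤ) (κ : Fin (d + 1)) (u : Fin (d + 1) → ℤ),
      (stepScale d Lc 0 * (Lc : ℝ) ^ (d + 1))⁻¹ • ∑ v ∈ box (d + 1) Lc, divV (fun κ' u' => cE₂ • wilsonW₂ d T κ u κ' u') ((Lc : ℤ) • Y + toSite v) =
        comp (((Lc : ℝ) ^ (d + 1)) • wilsonA d κ u) (diagK (((1 : ℝ) / 2) • ∑ v ∈ box (d + 1) Lc, legInd (toSite r) ((Lc : ℤ) • Y + toSite v)))
          - comp (diagK (((1 : ℝ) / 2) • ∑ v ∈ box (d + 1) Lc, legInd (toSite r) ((Lc : ℤ) • Y + toSite v))) (((Lc : ℝ) ^ (d + 1)) • wilsonA d κ u)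
          + RW'' Y κ u)
    (hBord : ∀ (Y : Fin (d + 1) → ℤ) (κ' : Fin (d + 1)) (u' : Fin (d + 1) → ℤ),
      (stepScale d Lc 0 * (Lc : ℝ) ^ (d + 1))⁻¹ • ∑ v ∈ box (d + 1) Lc, divV (fun κ u => cB • vh₂S κ u κ' u') ((Lc : ℤ) • Y + toSite v) =
        comp ((-((Lc : ℝ) ^ (d + 1) * (1 / 2) * (Lc : ℝ) ^ (d + 1))) • vhSAt (toSite r) d Lc rfl κ' u')
            (diagK (((1 : ℝ) / 2) • ∑ v ∈ box (d + 1) Lc, legInd (toSite r) ((Lc : ℤ) • Y + toSite v)))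
          - comp (diagK (((1 : ℝ) / 2) • ∑ v ∈ box (d + 1) Lc, legInd (toSite r) ((Lc : ℤ) • Y + toSite v)))
            ((-((Lc : ℝ) ^ (d + 1) * (1 / 2) * (Lc : ℝ) ^ (d + 1))) • vhSAt (toSite r) d Lc rfl κ' u')
          + RB Y κ' u')
    (hBord'' : ∀ (Y : Fin (d + 1) → ℤ) (κ : Fin (d + 1)) (u : Fin (d + 1) → ℤ),
      (stepScale d Lc 0 * (Lc : ℝ) ^ (d + 1))⁻¹ • ∑ v ∈ box (d + 1) Lc, divV (fun κ' u' => cB • vh₂S κ u κ' u') ((Lc : ℤ) • Y + toSite v) =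
        comp ((-((Lc : ℝ) ^ (d + 1) * (1 / 2) * (Lc : ℝ) ^ (d + 1))) • vhSAt (toSite r) d Lc rfl κ u)
            (diagK (((1 : ℝ) / 2) • ∑ v ∈ box (d + 1) Lc, legInd (toSite r) ((Lc : ℤ) • Y + toSite v)))
          - comp (diagK (((1 : ℝ) / 2) • ∑ v ∈ box (d + 1) Lc, legInd (toSite r) ((Lc : ℤ) • Y + toSite v)))
            ((-((Lc : ℝ) ^ (d + 1) * (1 / 2) * (Lc : ℝ) ^ (d + 1))) • vhSAt (toSite r) d Lc rfl κ u)
          + RB'' Y κ u)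
    (hM₂ : ∀ (y : Fin (d + 1) → ℤ) (ρ' : Fin (d + 1)) (w : Fin (d + 1) → ℤ),
      (stepScale d Lc 0 * (Lc : ℝ) ^ (d + 1))⁻¹ • ∑ v ∈ box (d + 1) Lc, divV (fun κ u => M2Of d Lc mixFF 0 κ u ρ' w) ((Lc : ℤ) • y + toSite v) =
        comp (M1At d Lc (toSite r) cΛ 0 ρ' w) (diagK (((1 : ℝ) / 2) • ∑ v ∈ box (d + 1) Lc, legInd (toSite r) ((Lc : ℤ) • y + toSite v)))
          - comp (diagK (((1 : ℝ) / 2) • ∑ v ∈ box (d + 1) Lc, legInd (toSite r) ((Lc : ℤ) • y + toSite v))) (M1At d Lc (toSite r) cΛ 0 ρ' w)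
          + RM y ρ' w)
    (y : Fin (d + 1) → ℤ) (ν : Fin (d + 1)) (y' : Fin (d + 1) → ℤ) :
    divW (WrecAt d Lc (toSite r) ((Lc : ℝ) ^ (d + 1)) (-((Lc : ℝ) ^ (d + 1) * (1 / 2) * (Lc : ℝ) ^ (d + 1))) cΛ cE₂ cB T vh₂S mixFF 0) y ν y' =
      conjV (dM (coDressKBmAt (toSite r) Lc (KInvStep (d := d) Lc 0)) Lc
            (SpureRecAt d Lc (toSite r) ((Lc : ℝ) ^ (d + 1)) (-((Lc : ℝ) ^ (d + 1) * (1 / 2) * (Lc : ℝ) ^ (d + 1))) cΛ 0)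
            (M1At d Lc (toSite r) cΛ 0) ν y')
          (diagK (((1 : ℝ) / 2) • ∑ v ∈ box (d + 1) Lc, legInd (toSite r) ((Lc : ℤ) • y + toSite v)))
        + (1 / 2 : ℝ) • (
          (dM (coDressKBmAt (toSite r) Lc (KInvStep (d := d) Lc 0)) Lc (fun κ u => RW y κ u + RB y κ u) (RM y) ν y'
            - (stepScale d Lc 0 * (Lc : ℝ) ^ (d + 1))⁻¹ • (∑ κ, wsum (fun u => ∑' x₂, ∑ κ₂,
                comp (coDressKBmAt (toSite r) Lc (KInvStep (d := d) Lc 0))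
                  (dM (coDressKBmAt (toSite r) Lc (KInvStep (d := d) Lc 0)) Lc
                    (SpureRecAt d Lc (toSite r) ((Lc : ℝ) ^ (d + 1)) (-((Lc : ℝ) ^ (d + 1) * (1 / 2) * (Lc : ℝ) ^ (d + 1))) cΛ 0)
                    (M1At d Lc (toSite r) cΛ 0) ν y') u x₂ (Sum.inl κ) (Sum.inl κ₂) * gaugeWt Lc y κ₂ x₂)
                (SpureRecAt d Lc (toSite r) ((Lc : ℝ) ^ (d + 1)) (-((Lc : ℝ) ^ (d + 1) * (1 / 2) * (Lc : ℝ) ^ (d + 1))) cΛ 0 κ)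
              + ∑ ρ', cwsum Lc (fun w => ∑' x₂, ∑ κ₂,
                comp (coDressKBmAt (toSite r) Lc (KInvStep (d := d) Lc 0))
                  (dM (coDressKBmAt (toSite r) Lc (KInvStep (d := d) Lc 0)) Lc
                    (SpureRecAt d Lc (toSite r) ((Lc : ℝ) ^ (d + 1)) (-((Lc : ℝ) ^ (d + 1) * (1 / 2) * (Lc : ℝ) ^ (d + 1))) cΛ 0)
                    (M1At d Lc (toSite r) cΛ 0) ν y') ((Lc : ℤ) • w) x₂ (Sum.inr ρ') (Sum.inl κ₂) * gaugeWt Lc y κ₂ x₂)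
                (M1At d Lc (toSite r) cΛ 0 ρ')))
          + (dM (coDressKBmAt (toSite r) Lc (KInvStep (d := d) Lc 0)) Lc (fun κ u => RW'' y κ u + RB'' y κ u) (RM y) ν y'
            + dM (conjV (coDressKBmAt (toSite r) Lc (KInvStep (d := d) Lc 0))
                (diagK (((1 : ℝ) / 2) • ∑ v ∈ box (d + 1) Lc, legInd (toSite r) ((Lc : ℤ) • y + toSite v)))) Lc
              (SpureRecAt d Lc (toSite r) ((Lc : ℝ) ^ (d + 1)) (-((Lc : ℝ) ^ (d + 1) * (1 / 2) * (Lc : ℝ) ^ (d + 1))) cΛ 0)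
              (M1At d Lc (toSite r) cΛ 0) ν y')) :=
  divW_WrecAt_of_tableLaws hLc hr cΛ cE₂ cB T hB hmix 0 (R := fun y κ u => RW y κ u + RB y κ u) (R'' := fun y κ u => RW'' y κ u + RB'' y κ u)
    (fun y κ u x z a b => abs_add_le' (hRWb y κ u) (hRBb y κ u) x z a b)
    (fun y κ u x z a b => abs_add_le' (hRW''b y κ u) (hRB''b y κ u) x z a b) hRMb
    (fun Y κ' u' => tableLaw_T2RecAt_zero cΛ cE₂ cB T vh₂S mixFF hWil hBord Y κ' u')
    (fun Y κ u => tableLaw_T2RecAt_zero'' cΛ cE₂ cB T vh₂S mixFF hWil'' hBord'' Y κ u) hM₂ y ν y'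

/-- [folklore] **THE LEVEL-0 RESIDUAL IS LOCALISED** when the letters' remainders are local-stencil / vertex families at one rate (`locStencil_add` + part B §2). -/
theorem loc_residual_WrecAt_zero (hLc : 1 ≤ Lc) {r : Fin (d + 1) → ℕ} (hr : r ∈ box (d + 1) Lc) (cΛ : ℝ)
    {RW RW'' RB RB'' : (Fin (d + 1) → ℤ) → Fin (d + 1) → (Fin (d + 1) → ℤ) → MKer (d + 1) (Fib d)}
    {RM : (Fin (d + 1) → ℤ) → Fin (d + 1) → (Fin (d + 1) → ℤ) → MKer (d + 1) (Fib d)} {CW CW'' CB CB'' CRM mR : ℝ} (hmR : 0 < mR)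
    (hRWl : ∀ y, LocStencil (RW y) CW mR) (hRW''l : ∀ y, LocStencil (RW'' y) CW'' mR)
    (hRBl : ∀ y, LocStencil (RB y) CB mR) (hRB''l : ∀ y, LocStencil (RB'' y) CB'' mR) (hRMl : ∀ y, VertexFamily (RM y) Lc CRM mR)
    (y : Fin (d + 1) → ℤ) (ν : Fin (d + 1)) (y' : Fin (d + 1) → ℤ) :
    Loc ((1 / 2 : ℝ) • (
          (dM (coDressKBmAt (toSite r) Lc (KInvStep (d := d) Lc 0)) Lc (fun κ u => RW y κ u + RB y κ u) (RM y) ν y'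
            - (stepScale d Lc 0 * (Lc : ℝ) ^ (d + 1))⁻¹ • (∑ κ, wsum (fun u => ∑' x₂, ∑ κ₂,
                comp (coDressKBmAt (toSite r) Lc (KInvStep (d := d) Lc 0))
                  (dM (coDressKBmAt (toSite r) Lc (KInvStep (d := d) Lc 0)) Lc
                    (SpureRecAt d Lc (toSite r) ((Lc : ℝ) ^ (d + 1)) (-((Lc : ℝ) ^ (d + 1) * (1 / 2) * (Lc : ℝ) ^ (d + 1))) cΛ 0)
                    (M1At d Lc (toSite r) cΛ 0) ν y') u x₂ (Sum.inl κ) (Sum.inl κ₂) * gaugeWt Lc y κ₂ x₂)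
                (SpureRecAt d Lc (toSite r) ((Lc : ℝ) ^ (d + 1)) (-((Lc : ℝ) ^ (d + 1) * (1 / 2) * (Lc : ℝ) ^ (d + 1))) cΛ 0 κ)
              + ∑ ρ', cwsum Lc (fun w => ∑' x₂, ∑ κ₂,
                comp (coDressKBmAt (toSite r) Lc (KInvStep (d := d) Lc 0))
                  (dM (coDressKBmAt (toSite r) Lc (KInvStep (d := d) Lc 0)) Lc
                    (SpureRecAt d Lc (toSite r) ((Lc : ℝ) ^ (d + 1)) (-((Lc : ℝ) ^ (d + 1) * (1 / 2) * (Lc : ℝ) ^ (d + 1))) cΛ 0)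
                    (M1At d Lc (toSite r) cΛ 0) ν y') ((Lc : ℤ) • w) x₂ (Sum.inr ρ') (Sum.inl κ₂) * gaugeWt Lc y κ₂ x₂)
                (M1At d Lc (toSite r) cΛ 0 ρ')))
          + (dM (coDressKBmAt (toSite r) Lc (KInvStep (d := d) Lc 0)) Lc (fun κ u => RW'' y κ u + RB'' y κ u) (RM y) ν y'
            + dM (conjV (coDressKBmAt (toSite r) Lc (KInvStep (d := d) Lc 0))
                (diagK (((1 : ℝ) / 2) • ∑ v ∈ box (d + 1) Lc, legInd (toSite r) ((Lc : ℤ) • y + toSite v)))) Lc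
              (SpureRecAt d Lc (toSite r) ((Lc : ℝ) ^ (d + 1)) (-((Lc : ℝ) ^ (d + 1) * (1 / 2) * (Lc : ℝ) ^ (d + 1))) cΛ 0)
              (M1At d Lc (toSite r) cΛ 0) ν y'))) :=
  loc_residual_WrecAt hLc hr cΛ 0 (R := fun y κ u => RW y κ u + RB y κ u) (R'' := fun y κ u => RW'' y κ u + RB'' y κ u) hmR
    (fun y => locStencil_add (hRWl y) (hRBl y)) (fun y => locStencil_add (hRW''l y) (hRB''l y)) hRMl y ν y'

/-! ## §2 The induction step `hWd j ⟹ hWd (j+1)` -/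

/-- [folklore] **THE INDUCTION STEP OF THE hW W-SIDE: THE LEVEL-`j` KERNEL LAW OF `WrecAt j` + THE TWO LEVEL-(j+1) LETTERS + THE PIN ⟹ THE LEVEL-(j+1)
KERNEL LAW OF `WrecAt (j+1)`** (hW Ward pin, in-block root, generator scale `½`, constant `cH_{j+1} = (stepScale (j+1)·Lc^{d+1})⁻¹`).  HYPOTHESES (displayed):
`hWd` — the level-`j` kernel law with a localised residual `𝒩` (`h𝒩`) whose `G_j`-sandwich block sums are uniformly bounded in both slots (`h𝒩b`, `h𝒩b''`; the
quantitative class of `𝒩` is the next seat's (HW-CLASS-Q)); the BORDER letters at level `j+1` in both slots (`hBord`, `hBord''`, remainders `RB`, `RB″` bounded); the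
MIXED letter at level `j+1` (`hM₂`, remainder `RM` bounded); the pin `cE₂ = Lc^{2(d+1)}`.  CONCLUSION: part B's kernel law at level `j+1` with
`R := −(cH_{j+1}·cE₂·wV4 (j+1)) • Σ_v mmRead Lc (G_j∘𝒩 (Lc•Y+v) κ′ u′∘G_j) + RB` and its second-slot twin — parts A §3/§5 ∘ B §1. -/
theorem divW_WrecAt_succ_of_kernelLaw (hLc : 1 ≤ Lc) {r : Fin (d + 1) → ℕ} (hr : r ∈ box (d + 1) Lc) (cΛ cB : ℝ) {cE₂ : ℝ}
    (hcE₂ : cE₂ = (Lc : ℝ) ^ (2 * (d + 1))) (T : Fin 4 → Fin 4 → Fin 4 → Fin 4 → ℝ)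
    {vh₂S : Fin (d + 1) → (Fin (d + 1) → ℤ) → Fin (d + 1) → (Fin (d + 1) → ℤ) → MKer (d + 1) (Fib d)}
    (hB : ∃ C δ : ℝ, 0 < δ ∧ LocStencil₂ vh₂S C δ)
    {mixFF : Fin (d + 1) → (Fin (d + 1) → ℤ) → Fin (d + 1) → (Fin (d + 1) → ℤ) → MKer (d + 1) (Fib d)}
    (hmix : ∃ C δ : ℝ, 0 < δ ∧ LocStencilFM Lc mixFF C δ) (j : ℕ)
    -- the level-`j` kernel law (induction hypothesis) with its localised residual and the uniform bound of its transported sandwich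
    {𝒩 : (Fin (d + 1) → ℤ) → Fin (d + 1) → (Fin (d + 1) → ℤ) → MKer (d + 1) (Fib d)} (h𝒩 : ∀ y ν y', Loc (𝒩 y ν y'))
    (hWd : ∀ (y : Fin (d + 1) → ℤ) (ν : Fin (d + 1)) (y' : Fin (d + 1) → ℤ),
      divW (WrecAt d Lc (toSite r) ((Lc : ℝ) ^ (d + 1)) (-((Lc : ℝ) ^ (d + 1) * (1 / 2) * (Lc : ℝ) ^ (d + 1))) cΛ cE₂ cB T vh₂S mixFF j) y ν y' =
        conjV (dM (coDressKBmAt (toSite r) Lc (KInvStep (d := d) Lc j)) Lc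
            (SpureRecAt d Lc (toSite r) ((Lc : ℝ) ^ (d + 1)) (-((Lc : ℝ) ^ (d + 1) * (1 / 2) * (Lc : ℝ) ^ (d + 1))) cΛ j)
            (M1At d Lc (toSite r) cΛ j) ν y')
          (diagK (((1 : ℝ) / 2) • ∑ v ∈ box (d + 1) Lc, legInd (toSite r) ((Lc : ℤ) • y + toSite v))) + 𝒩 y ν y')
    {B𝒩 B𝒩'' : ℝ}
    (h𝒩b : ∀ (Y : Fin (d + 1) → ℤ) (κ' : Fin (d + 1)) (u' : Fin (d + 1) → ℤ) x z a b,
      |(∑ v ∈ box (d + 1) Lc, mmRead Lc (comp (comp (coDressKBmAt (toSite r) Lc (KInvStep (d := d) Lc j)) (𝒩 ((Lc : ℤ) • Y + toSite v) κ' u'))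
        (coDressKBmAt (toSite r) Lc (KInvStep (d := d) Lc j)))) x z a b| ≤ B𝒩)
    (h𝒩b'' : ∀ (Y : Fin (d + 1) → ℤ) (κ : Fin (d + 1)) (u : Fin (d + 1) → ℤ) x z a b,
      |(∑ v ∈ box (d + 1) Lc, mmRead Lc (comp (comp (coDressKBmAt (toSite r) Lc (KInvStep (d := d) Lc j)) (𝒩 ((Lc : ℤ) • Y + toSite v) κ u))
        (coDressKBmAt (toSite r) Lc (KInvStep (d := d) Lc j)))) x z a b| ≤ B𝒩'')
    -- the two level-(j+1) letters (an1's lane), bounded remainders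
    {RB RB'' : (Fin (d + 1) → ℤ) → Fin (d + 1) → (Fin (d + 1) → ℤ) → MKer (d + 1) (Fib d)} {BB BB'' : ℝ}
    (hRBb : ∀ y κ u x z a b, |RB y κ u x z a b| ≤ BB) (hRB''b : ∀ y κ u x z a b, |RB'' y κ u x z a b| ≤ BB'')
    (hBord : ∀ (Y : Fin (d + 1) → ℤ) (κ' : Fin (d + 1)) (u' : Fin (d + 1) → ℤ),
      (stepScale d Lc (j + 1) * (Lc : ℝ) ^ (d + 1))⁻¹ •
          ∑ v ∈ box (d + 1) Lc, divV (fun κ u => (cB * wB2 d Lc (j + 1)) • vh₂S κ u κ' u') ((Lc : ℤ) • Y + toSite v) =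
        comp ((-((Lc : ℝ) ^ (d + 1) * (1 / 2) * (Lc : ℝ) ^ (d + 1)) * wVH d Lc (j + 1)) • vhSAt (toSite r) d Lc rfl κ' u')
            (diagK (((1 : ℝ) / 2) • ∑ v ∈ box (d + 1) Lc, legInd (toSite r) ((Lc : ℤ) • Y + toSite v)))
          - comp (diagK (((1 : ℝ) / 2) • ∑ v ∈ box (d + 1) Lc, legInd (toSite r) ((Lc : ℤ) • Y + toSite v)))
            ((-((Lc : ℝ) ^ (d + 1) * (1 / 2) * (Lc : ℝ) ^ (d + 1)) * wVH d Lc (j + 1)) • vhSAt (toSite r) d Lc rfl κ' u')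
          + RB Y κ' u')
    (hBord'' : ∀ (Y : Fin (d + 1) → ℤ) (κ : Fin (d + 1)) (u : Fin (d + 1) → ℤ),
      (stepScale d Lc (j + 1) * (Lc : ℝ) ^ (d + 1))⁻¹ •
          ∑ v ∈ box (d + 1) Lc, divV (fun κ' u' => (cB * wB2 d Lc (j + 1)) • vh₂S κ u κ' u') ((Lc : ℤ) • Y + toSite v) =
        comp ((-((Lc : ℝ) ^ (d + 1) * (1 / 2) * (Lc : ℝ) ^ (d + 1)) * wVH d Lc (j + 1)) • vhSAt (toSite r) d Lc rfl κ u)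
            (diagK (((1 : ℝ) / 2) • ∑ v ∈ box (d + 1) Lc, legInd (toSite r) ((Lc : ℤ) • Y + toSite v)))
          - comp (diagK (((1 : ℝ) / 2) • ∑ v ∈ box (d + 1) Lc, legInd (toSite r) ((Lc : ℤ) • Y + toSite v)))
            ((-((Lc : ℝ) ^ (d + 1) * (1 / 2) * (Lc : ℝ) ^ (d + 1)) * wVH d Lc (j + 1)) • vhSAt (toSite r) d Lc rfl κ u)
          + RB'' Y κ u)
    {RM : (Fin (d + 1) → ℤ) → Fin (d + 1) → (Fin (d + 1) → ℤ) → MKer (d + 1) (Fib d)} {BR' : ℝ}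
    (hRMb : ∀ y ρ w x z a b, |RM y ρ w x z a b| ≤ BR')
    (hM₂ : ∀ (y : Fin (d + 1) → ℤ) (ρ' : Fin (d + 1)) (w : Fin (d + 1) → ℤ),
      (stepScale d Lc (j + 1) * (Lc : ℝ) ^ (d + 1))⁻¹ •
          ∑ v ∈ box (d + 1) Lc, divV (fun κ u => M2Of d Lc mixFF (j + 1) κ u ρ' w) ((Lc : ℤ) • y + toSite v) =
        comp (M1At d Lc (toSite r) cΛ (j + 1) ρ' w) (diagK (((1 : ℝ) / 2) • ∑ v ∈ box (d + 1) Lc, legInd (toSite r) ((Lc : ℤ) • y + toSite v)))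
          - comp (diagK (((1 : ℝ) / 2) • ∑ v ∈ box (d + 1) Lc, legInd (toSite r) ((Lc : ℤ) • y + toSite v))) (M1At d Lc (toSite r) cΛ (j + 1) ρ' w)
          + RM y ρ' w)
    (y : Fin (d + 1) → ℤ) (ν : Fin (d + 1)) (y' : Fin (d + 1) → ℤ) :
    divW (WrecAt d Lc (toSite r) ((Lc : ℝ) ^ (d + 1)) (-((Lc : ℝ) ^ (d + 1) * (1 / 2) * (Lc : ℝ) ^ (d + 1))) cΛ cE₂ cB T vh₂S mixFF (j + 1)) y ν y' =
      conjV (dM (coDressKBmAt (toSite r) Lc (KInvStep (d := d) Lc (j + 1))) Lc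
            (SpureRecAt d Lc (toSite r) ((Lc : ℝ) ^ (d + 1)) (-((Lc : ℝ) ^ (d + 1) * (1 / 2) * (Lc : ℝ) ^ (d + 1))) cΛ (j + 1))
            (M1At d Lc (toSite r) cΛ (j + 1)) ν y')
          (diagK (((1 : ℝ) / 2) • ∑ v ∈ box (d + 1) Lc, legInd (toSite r) ((Lc : ℤ) • y + toSite v)))
        + (1 / 2 : ℝ) • (
          (dM (coDressKBmAt (toSite r) Lc (KInvStep (d := d) Lc (j + 1))) Lc
              (fun κ' u' => -((stepScale d Lc (j + 1) * (Lc : ℝ) ^ (d + 1))⁻¹ * (cE₂ * wV4 d Lc (j + 1))) •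
                  ∑ v ∈ box (d + 1) Lc, mmRead Lc (comp (comp (coDressKBmAt (toSite r) Lc (KInvStep (d := d) Lc j))
                    (𝒩 ((Lc : ℤ) • y + toSite v) κ' u')) (coDressKBmAt (toSite r) Lc (KInvStep (d := d) Lc j)))
                + RB y κ' u') (RM y) ν y'
            - (stepScale d Lc (j + 1) * (Lc : ℝ) ^ (d + 1))⁻¹ • (∑ κ, wsum (fun u => ∑' x₂, ∑ κ₂,
                comp (coDressKBmAt (toSite r) Lc (KInvStep (d := d) Lc (j + 1)))
                  (dM (coDressKBmAt (toSite r) Lc (KInvStep (d := d) Lc (j + 1))) Lc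
                    (SpureRecAt d Lc (toSite r) ((Lc : ℝ) ^ (d + 1)) (-((Lc : ℝ) ^ (d + 1) * (1 / 2) * (Lc : ℝ) ^ (d + 1))) cΛ (j + 1))
                    (M1At d Lc (toSite r) cΛ (j + 1)) ν y') u x₂ (Sum.inl κ) (Sum.inl κ₂) * gaugeWt Lc y κ₂ x₂)
                (SpureRecAt d Lc (toSite r) ((Lc : ℝ) ^ (d + 1)) (-((Lc : ℝ) ^ (d + 1) * (1 / 2) * (Lc : ℝ) ^ (d + 1))) cΛ (j + 1) κ)
              + ∑ ρ', cwsum Lc (fun w => ∑' x₂, ∑ κ₂,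
                comp (coDressKBmAt (toSite r) Lc (KInvStep (d := d) Lc (j + 1)))
                  (dM (coDressKBmAt (toSite r) Lc (KInvStep (d := d) Lc (j + 1))) Lc
                    (SpureRecAt d Lc (toSite r) ((Lc : ℝ) ^ (d + 1)) (-((Lc : ℝ) ^ (d + 1) * (1 / 2) * (Lc : ℝ) ^ (d + 1))) cΛ (j + 1))
                    (M1At d Lc (toSite r) cΛ (j + 1)) ν y') ((Lc : ℤ) • w) x₂ (Sum.inr ρ') (Sum.inl κ₂) * gaugeWt Lc y κ₂ x₂)
                (M1At d Lc (toSite r) cΛ (j + 1) ρ')))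
          + (dM (coDressKBmAt (toSite r) Lc (KInvStep (d := d) Lc (j + 1))) Lc
              (fun κ u => -((stepScale d Lc (j + 1) * (Lc : ℝ) ^ (d + 1))⁻¹ * (cE₂ * wV4 d Lc (j + 1))) •
                  ∑ v ∈ box (d + 1) Lc, mmRead Lc (comp (comp (coDressKBmAt (toSite r) Lc (KInvStep (d := d) Lc j))
                    (𝒩 ((Lc : ℤ) • y + toSite v) κ u)) (coDressKBmAt (toSite r) Lc (KInvStep (d := d) Lc j)))
                + RB'' y κ u) (RM y) ν y'
            + dM (conjV (coDressKBmAt (toSite r) Lc (KInvStep (d := d) Lc (j + 1)))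
                (diagK (((1 : ℝ) / 2) • ∑ v ∈ box (d + 1) Lc, legInd (toSite r) ((Lc : ℤ) • y + toSite v)))) Lc
              (SpureRecAt d Lc (toSite r) ((Lc : ℝ) ^ (d + 1)) (-((Lc : ℝ) ^ (d + 1) * (1 / 2) * (Lc : ℝ) ^ (d + 1))) cΛ (j + 1))
              (M1At d Lc (toSite r) cΛ (j + 1)) ν y')) :=
  divW_WrecAt_of_tableLaws hLc hr cΛ cE₂ cB T hB hmix (j + 1)
    (R := fun Y κ' u' => -((stepScale d Lc (j + 1) * (Lc : ℝ) ^ (d + 1))⁻¹ * (cE₂ * wV4 d Lc (j + 1))) •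
        ∑ v ∈ box (d + 1) Lc, mmRead Lc (comp (comp (coDressKBmAt (toSite r) Lc (KInvStep (d := d) Lc j))
          (𝒩 ((Lc : ℤ) • Y + toSite v) κ' u')) (coDressKBmAt (toSite r) Lc (KInvStep (d := d) Lc j))) + RB Y κ' u')
    (R'' := fun Y κ u => -((stepScale d Lc (j + 1) * (Lc : ℝ) ^ (d + 1))⁻¹ * (cE₂ * wV4 d Lc (j + 1))) •
        ∑ v ∈ box (d + 1) Lc, mmRead Lc (comp (comp (coDressKBmAt (toSite r) Lc (KInvStep (d := d) Lc j))
          (𝒩 ((Lc : ℤ) • Y + toSite v) κ u)) (coDressKBmAt (toSite r) Lc (KInvStep (d := d) Lc j))) + RB'' Y κ u)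
    (fun Y κ' u' x z a b => abs_smul_add_le _ (h𝒩b Y κ' u') (hRBb Y κ' u') x z a b)
    (fun Y κ u x z a b => abs_smul_add_le _ (h𝒩b'' Y κ u) (hRB''b Y κ u) x z a b) hRMb
    (fun Y κ' u' => tableLaw_T2RecAt_succ hLc hr cΛ cE₂ cB T hB hmix j h𝒩 hWd (lock_succ_of_pin (d := d) hLc hcE₂ j) hBord Y κ' u')
    (fun Y κ u => tableLaw_T2RecAt_succ'' hLc hr cΛ cE₂ cB T hB hmix j h𝒩 hWd (lock_succ_of_pin (d := d) hLc hcE₂ j) hBord'' Y κ u)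
    hM₂ y ν y'

end Wall

end Summit.QuantumFields.BalabanUV.Beta.WardLocusRecursiveAll

end
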